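import Mathlib.LinearAlgebra.Matrix.Adjugate
import Mathlib.LinearAlgebra.Matrix.NonsingularInverse
import Mathlib.LinearAlgebra.Matrix.Block
import Mathlib.Algebra.Ring.GeomSum
import Mathlib.Data.Fin.Tuple.Basic
import Mathlib.Data.Fintype.Powerset
import Literature.Computability.AlgebraicComplexity.PermanentVsDeterminant
import HarnessLib

/-!
# Grenet's upper bound `dc(PER_n) ≤ 2ⁿ - 1`: proof

Sibling proofs file of `Literature/Computability/AlgebraicComplexity/PermanentVsDeterminant.lean`:
`Literature.Computability.AlgebraicComplexity.determinantalComplexity_perPoly_le_holds` discharges the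
named fact `determinantalComplexity_perPoly_le` (Grenet 2011, Thm. 1 = Grenet's thesis 2012,
Thm. 3.16): over any field and for `n ≥ 1` the generic `n × n` permanent is the determinant of a
`(2ⁿ - 1) × (2ⁿ - 1)` matrix whose entries are `0`, `±1` or `±` a variable.

## The argument

Grenet's algebraic branching program for the permanent (thesis, Lemme 3.17): the vertices are the
subsets `S ⊆ Fin n`, with an arc `S → insert j S` of weight `x_{j,|S|}` for every `j ∉ S`; the
paths from `∅` to `univ` are the orderings `(j₀, …, j_{n-1})` of `Fin n`, i.e. the permutations,
with weight `∏ₜ x_{jₜ,t}`, so the path sum is `PER_n`. Grenet then merges source and sink, adds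
loops, and counts cycle covers (thesis, proof of Thm. 3.16). We replace the cycle-cover count by
linear algebra: with `A` the weighted adjacency matrix,

* `(Aᵐ) S T` is the sum over injective `g : Fin m → Fin n` avoiding `S` with `S ∪ im g = T` of
  `∏ₜ w (g t) (|S| + t)` (`Grenet.pow_apply`, induction on `m`, peeling off the first arc with
  `Fin.cons`); in particular `A ^ (n + 1) = 0` and `(Aⁿ) ∅ univ = PER_n`;
* `1 - A` is block-unitriangular for the grading by cardinality, so `det (1 - A) = 1`, and
  `(1 - A) * ∑_{i ≤ n} Aⁱ = 1`; hence `adjugate (1 - A) = (1 - A)⁻¹ = ∑_{i ≤ n} Aⁱ`, whose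
  `(∅, univ)` entry is `PER_n`;
* after reindexing along `Finset (Fin n) ≃ Fin (N + 1)` (`N + 1 = 2ⁿ`), that adjugate entry is
  `±` the determinant of the `N × N` minor deleting the row of `univ` and the column of `∅`
  (`Matrix.adjugate_fin_succ_eq_det_submatrix`); multiplying the minor by the sign `± 1` fixes the
  determinant because `N = 2ⁿ - 1` is odd. This minor is exactly the adjacency matrix of Grenet's
  merged graph (up to the signs of the entries), of size `2ⁿ - 1`.

No new definitions: the adjacency matrix and the weights enter the auxiliary lemmas through
characterising hypotheses (`hA`).

## Sources

* B. Grenet, *An upper bound for the permanent versus determinant problem*, manuscript (2011),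
  Thm. 1 (keys `Grenet2011`, `GrenetPermDet2011`).
* B. Grenet, *Représentations des polynômes, algorithmes et bornes inférieures*, PhD thesis,
  ENS Lyon (2012), Lemme 3.17 and Thm. 3.16, p. 61 (key `Grenet2012Thesis`).
* J. M. Landsberg, N. Ressayre, *Permanent v. determinant: an exponential lower bound assuming
  symmetry*, ITCS 2016, §2.2 "Grenet's formulas" (size `2^m - 1`).
-/

noncomputable section

open MvPolynomial Matrix Finset

namespace Literature.Computability.AlgebraicComplexity

namespace Grenet

variable {α : Type*} [Fintype α] [DecidableEq α] {R : Type*} [CommRing R]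

/-- **Paths in Grenet's branching program.** Let `A` be the weighted adjacency matrix of the
subset lattice of `α`: an arc `S → insert j S` of weight `w j |S|` for every `j ∉ S`. Then the
`(S, T)` entry of `Aᵐ` (the sum of the weights of the paths of length `m` from `S` to `T`) is the
sum, over the injective sequences `g : Fin m → α` avoiding `S` with `S ∪ im g = T`, of
`∏ₜ w (g t) (|S| + t)` (Grenet 2012, Lemme 3.17: for `S = ∅`, `T = univ` these are the
permutations). [cite: Grenet2012Thesis, Lemme 3.17] -/
theorem pow_apply (w : α → ℕ → R) {A : Matrix (Finset α) (Finset α) R}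
    (hA : ∀ S T, A S T = ∑ j, if j ∉ S ∧ T = insert j S then w j S.card else 0)
    (m : ℕ) (S T : Finset α) :
    (A ^ m) S T = ∑ g : Fin m → α,
      if Function.Injective g ∧ (∀ t, g t ∉ S) ∧ S ∪ univ.image g = T
      then ∏ t, w (g t) (S.card + t) else 0 := by
  induction m generalizing S with
  | zero =>
    simp [Matrix.one_apply, Function.injective_of_subsingleton]
  | succ m ih =>
    have hcons_image : ∀ (j : α) (g : Fin m → α),
        univ.image (Fin.cons j g : Fin (m + 1) → α) = insert j (univ.image g) := by
      intro j g
      ext a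
      simp [Fin.exists_fin_succ, eq_comm]
    rw [pow_succ', Matrix.mul_apply]
    calc ∑ U, A S U * (A ^ m) U T
        = ∑ U, ∑ j, (if j ∉ S ∧ U = insert j S then w j S.card * (A ^ m) U T else 0) := by
          refine sum_congr rfl fun U _ => ?_
          rw [hA, sum_mul]
          refine sum_congr rfl fun j _ => ?_
          split_ifs <;> simp
      _ = ∑ j, (if j ∉ S then w j S.card * (A ^ m) (insert j S) T else 0) := by
          rw [sum_comm]
          refine sum_congr rfl fun j _ => ?_
          by_cases hj : j ∈ S
          · rw [if_neg (not_not_intro hj)]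
            exact sum_eq_zero fun U _ => if_neg fun h => h.1 hj
          · rw [if_pos hj, sum_eq_single_of_mem (insert j S) (mem_univ _)
              (fun U _ hU => if_neg fun h => hU h.2), if_pos ⟨hj, rfl⟩]
      _ = ∑ j, ∑ g : Fin m → α, (if j ∉ S ∧ (Function.Injective g ∧ (∀ t, g t ∉ insert j S) ∧
            insert j S ∪ univ.image g = T) then w j S.card * ∏ t, w (g t) (S.card + 1 + t)
            else 0) := by
          refine sum_congr rfl fun j _ => ?_
          by_cases hj : j ∈ S
          · rw [if_neg (not_not_intro hj)]
            exact (sum_eq_zero fun g _ => if_neg fun h => h.1 hj).symm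
          · rw [if_pos hj, ih (insert j S), mul_sum, card_insert_of_notMem hj]
            refine sum_congr rfl fun g _ => ?_
            by_cases hg : Function.Injective g ∧ (∀ t, g t ∉ insert j S) ∧
                insert j S ∪ univ.image g = T
            · rw [if_pos hg, if_pos ⟨hj, hg⟩]
            · rw [if_neg hg, if_neg fun h => hg h.2, mul_zero]
      _ = ∑ p : α × (Fin m → α), (if p.1 ∉ S ∧ (Function.Injective p.2 ∧
            (∀ t, p.2 t ∉ insert p.1 S) ∧ insert p.1 S ∪ univ.image p.2 = T)
            then w p.1 S.card * ∏ t, w (p.2 t) (S.card + 1 + t) else 0) :=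
          (Fintype.sum_prod_type' _).symm
      _ = _ := by
          refine Fintype.sum_equiv (Fin.consEquiv fun _ => α) _ _ fun p => ?_
          obtain ⟨j, g⟩ := p
          rw [show (Fin.consEquiv fun _ => α) (j, g) = Fin.cons j g from rfl]
          have hiff : (Function.Injective (Fin.cons j g : Fin (m + 1) → α) ∧
              (∀ t, (Fin.cons j g : Fin (m + 1) → α) t ∉ S) ∧
              S ∪ univ.image (Fin.cons j g : Fin (m + 1) → α) = T) ↔
              (j ∉ S ∧ (Function.Injective g ∧ (∀ t, g t ∉ insert j S) ∧
              insert j S ∪ univ.image g = T)) := by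
            simp only [Fin.cons_injective_iff, Fin.forall_fin_succ, Fin.cons_zero, Fin.cons_succ,
              hcons_image, Set.mem_range, not_exists, mem_insert, not_or, forall_and,
              union_insert, insert_union]
            tauto
          by_cases hc : j ∉ S ∧ (Function.Injective g ∧ (∀ t, g t ∉ insert j S) ∧
              insert j S ∪ univ.image g = T)
          · rw [if_pos hc, if_pos (hiff.mpr hc), Fin.prod_univ_succ, Fin.cons_zero, Fin.val_zero,
              add_zero]
            congr 1
            refine prod_congr rfl fun t _ => ?_
            rw [Fin.cons_succ, Fin.val_succ, ← add_assoc, add_right_comm]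
          · rw [if_neg hc, if_neg fun h => hc (hiff.mp h)]

/-- The weighted adjacency matrix `A` of the subset lattice (arcs raise the cardinality by one) is
nilpotent relative to the grading by cardinality: `1 - A` is block upper-unitriangular for
`Finset.card`, hence `det (1 - A) = 1`. [folklore] -/
theorem det_one_sub (w : α → ℕ → R) {A : Matrix (Finset α) (Finset α) R}
    (hA : ∀ S T, A S T = ∑ j, if j ∉ S ∧ T = insert j S then w j S.card else 0) :
    (1 - A).det = 1 := by
  have hAST : ∀ S T, T.card ≤ S.card → A S T = 0 := by
    intro S T hle
    rw [hA]
    refine sum_eq_zero fun j _ => if_neg ?_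
    rintro ⟨hj, rfl⟩
    rw [card_insert_of_notMem hj] at hle
    omega
  have hT : (1 - A).BlockTriangular Finset.card := by
    intro S T hlt
    have hne : S ≠ T := by
      rintro rfl
      exact lt_irrefl _ hlt
    rw [Matrix.sub_apply, Matrix.one_apply_ne hne, hAST S T hlt.le, sub_zero]
  rw [hT.det]
  refine prod_eq_one fun c _ => ?_
  rw [show (1 - A).toSquareBlock Finset.card c = 1 from ?_, Matrix.det_one]
  ext ⟨S, hS⟩ ⟨T, hT'⟩
  rw [Matrix.toSquareBlock_def, Matrix.of_apply, Matrix.sub_apply, hAST S T (by rw [hS, hT']),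
    sub_zero, Matrix.one_apply, Matrix.one_apply]
  simp only [Subtype.mk.injEq]

variable {n : ℕ}

/-- For `α = Fin n` the weighted adjacency matrix of the subset lattice satisfies `A ^ (n + 1) = 0`
(there is no injective `Fin (n + 1) → Fin n`; all paths have length `≤ n`). [folklore] -/
theorem pow_succ_eq_zero (w : Fin n → ℕ → R) {A : Matrix (Finset (Fin n)) (Finset (Fin n)) R}
    (hA : ∀ S T, A S T = ∑ j, if j ∉ S ∧ T = insert j S then w j S.card else 0) :
    A ^ (n + 1) = 0 := by
  ext S T
  rw [pow_apply w hA, Matrix.zero_apply]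
  refine sum_eq_zero fun g _ => if_neg ?_
  rintro ⟨hg, -, -⟩
  simpa using Fintype.card_le_of_injective g hg

/-- The adjugate of the unipotent matrix `1 - A` (with `A` the weighted adjacency matrix of the
subset lattice of `Fin n`) is its inverse, the finite geometric series `∑_{i ≤ n} Aⁱ`
(`det (1 - A) = 1`, `A ^ (n + 1) = 0`). [folklore] -/
theorem adjugate_one_sub (w : Fin n → ℕ → R) {A : Matrix (Finset (Fin n)) (Finset (Fin n)) R}
    (hA : ∀ S T, A S T = ∑ j, if j ∉ S ∧ T = insert j S then w j S.card else 0) :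
    (1 - A).adjugate = ∑ i ∈ range (n + 1), A ^ i := by
  have hmul : (1 - A) * ∑ i ∈ range (n + 1), A ^ i = 1 := by
    rw [mul_neg_geom_sum, pow_succ_eq_zero w hA, sub_zero]
  have hinv := Matrix.inv_eq_right_inv hmul
  rwa [Matrix.inv_def, det_one_sub w hA, Ring.inverse_one, one_smul] at hinv

/-- **The path sum of Grenet's branching program is the permanent** (Grenet 2012, Lemme 3.17), in
matrix form: the `(∅, univ)` entry of `adjugate (1 - A) = ∑_{i ≤ n} Aⁱ` is `(Aⁿ) ∅ univ`, the
sum over the injective (equivalently bijective) `g : Fin n → Fin n` of `∏ₜ w (g t) t`. [cite: Grenet2012Thesis, Lemme 3.17] -/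
theorem adjugate_one_sub_empty_univ (w : Fin n → ℕ → R)
    {A : Matrix (Finset (Fin n)) (Finset (Fin n)) R}
    (hA : ∀ S T, A S T = ∑ j, if j ∉ S ∧ T = insert j S then w j S.card else 0) :
    (1 - A).adjugate ∅ univ =
      ∑ g : Fin n → Fin n, if Function.Injective g then ∏ t, w (g t) t else 0 := by
  rw [adjugate_one_sub w hA, Matrix.sum_apply, sum_eq_single_of_mem n (by simp) ?_]
  · rw [pow_apply w hA]
    refine sum_congr rfl fun g _ => ?_
    by_cases hg : Function.Injective g
    · have himg : univ.image g = univ :=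
        image_univ_of_surjective (Finite.injective_iff_surjective.mp hg)
      simp [hg, himg]
    · simp [hg]
  · intro i _ hin
    rw [pow_apply w hA]
    refine sum_eq_zero fun g _ => if_neg ?_
    rintro ⟨hg, -, hT⟩
    rw [empty_union] at hT
    have hcard := card_image_of_injective univ hg
    rw [hT, card_univ, Fintype.card_fin, card_univ, Fintype.card_fin] at hcard
    exact hin hcard.symm

/-- Summing `F g` over the injective self-maps `g` of a finite type is summing `F σ` over its
permutations `σ`. [folklore] -/
theorem sum_ite_injective (F : (α → α) → R) :
    (∑ g : α → α, if Function.Injective g then F g else 0) = ∑ σ : Equiv.Perm α, F σ := by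
  rw [← sum_filter]
  symm
  refine sum_bij (fun σ _ => ⇑σ) (fun σ _ => by simpa using σ.injective)
    (fun σ _ τ _ h => Equiv.ext (congrFun h)) (fun g hg => ?_) (fun σ _ => rfl)
  rw [mem_filter] at hg
  exact ⟨Equiv.ofBijective g (Finite.injective_iff_bijective.mp hg.2), mem_univ _, rfl⟩

end Grenet

/-- **Grenet's upper bound** `dc(PER_n) ≤ 2ⁿ - 1` (`n ≥ 1`, any field): discharge of the named
fact `determinantalComplexity_perPoly_le` (Grenet 2011, Thm. 1; Grenet's thesis 2012, Thm. 3.16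
with Lemme 3.17). The affine matrix is `± D`, where `D` is the minor (row `univ`, column `∅`
deleted) of `1 - A` for the weighted adjacency matrix `A` of Grenet's branching program on the
subsets of `Fin n` (arc `S → insert j S` of weight `X (j, |S|)`), reindexed along
`Finset (Fin n) ≃ Fin 2ⁿ`; its entries are `0`, `±1`, `± X (j, c)`. [cite: Grenet2011, Thm. 1] -/
theorem determinantalComplexity_perPoly_le_holds : determinantalComplexity_perPoly_le := by
  intro k _ n hn
  obtain ⟨N, hN⟩ : ∃ N, 2 ^ n = N + 1 := ⟨2 ^ n - 1, by have := @Nat.one_le_two_pow n; omega⟩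
  rw [hN, Nat.add_sub_cancel]
  apply determinantalComplexity_le_of_hasDetRepr
  -- the weights `w j c = X (j, c)` (junk `0` for `c ≥ n`, never used) and the adjacency matrix
  obtain ⟨w, hwX, hwdeg⟩ : ∃ w : Fin n → ℕ → MvPolynomial (Fin n × Fin n) k,
      (∀ (j : Fin n) (c : Fin n), w j c = X (j, c)) ∧ ∀ j c, (w j c).totalDegree ≤ 1 := by
    refine ⟨fun j c => if h : c < n then X (j, ⟨c, h⟩) else 0, fun j c => by simp, fun j c => ?_⟩
    dsimp only
    split_ifs
    · exact (totalDegree_X _).le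
    · simp
  obtain ⟨A, hA⟩ : ∃ A : Matrix (Finset (Fin n)) (Finset (Fin n)) (MvPolynomial (Fin n × Fin n) k),
      ∀ S T, A S T = ∑ j, if j ∉ S ∧ T = insert j S then w j S.card else 0 :=
    ⟨Matrix.of fun S T => ∑ j, if j ∉ S ∧ T = insert j S then w j S.card else 0, fun _ _ => rfl⟩
  have hcard : Fintype.card (Finset (Fin n)) = N + 1 := by
    rw [Fintype.card_finset, Fintype.card_fin, hN]
  obtain ⟨e⟩ : Nonempty (Finset (Fin n) ≃ Fin (N + 1)) := ⟨Fintype.equivFinOfCardEq hcard⟩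
  -- the entries of `1 - A` are affine
  have hdeg : ∀ S T, ((1 - A) S T).totalDegree ≤ 1 := by
    intro S T
    rw [Matrix.sub_apply]
    refine (totalDegree_sub _ _).trans (max_le ?_ ?_)
    · rw [Matrix.one_apply]
      split_ifs <;> simp
    · rw [hA]
      refine totalDegree_finsetSum_le fun j _ => ?_
      split_ifs
      · exact hwdeg _ _
      · simp
  -- the `(∅, univ)` cofactor of `1 - A` is the permanent
  have hadj : ((1 - A).submatrix e.symm e.symm).adjugate (e ∅) (e univ) = perPoly (Fin n) k := by
    rw [Matrix.adjugate_submatrix_equiv_self, Matrix.submatrix_apply, e.symm_apply_apply,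
      e.symm_apply_apply, Grenet.adjugate_one_sub_empty_univ w hA, Grenet.sum_ite_injective,
      perPoly, Matrix.permanent]
    refine sum_congr rfl fun σ _ => prod_congr rfl fun t _ => ?_
    rw [hwX, Matrix.mvPolynomialX_apply]
  rw [Matrix.adjugate_fin_succ_eq_det_submatrix] at hadj
  have hodd : Odd N := by
    have h2 : Even (N + 1) := hN ▸ Nat.even_pow.mpr ⟨even_two, by omega⟩
    exact Nat.not_even_iff_odd.mp (Nat.even_add_one.mp h2)
  refine ⟨(-1 : MvPolynomial (Fin n × Fin n) k) ^ ((e univ : ℕ) + (e ∅ : ℕ)) •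
    ((1 - A).submatrix e.symm e.symm).submatrix (e univ).succAbove (e ∅).succAbove, ?_, ?_⟩
  · intro p q
    rw [Matrix.smul_apply, smul_eq_mul]
    refine (totalDegree_mul _ _).trans ?_
    have h1 : ((-1 : MvPolynomial (Fin n × Fin n) k) ^ ((e univ : ℕ) + (e ∅ : ℕ))).totalDegree
        = 0 := by
      refine Nat.eq_zero_of_le_zero ((totalDegree_pow _ _).trans ?_)
      rw [totalDegree_neg, totalDegree_one, mul_zero]
    rw [h1, zero_add]
    exact hdeg _ _
  · rw [Matrix.det_smul, Fintype.card_fin, ← pow_mul, pow_mul', hodd.neg_one_pow]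
    exact hadj

end Literature.Computability.AlgebraicComplexity
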